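import Summits.ABC.IUTFork.ForkGenuineRegimes
import Summits.ABC.IUTFork.LDHPerPrimeReadingSlotConstant
import Mathlib.Analysis.Complex.ExponentialBounds
import HarnessLib

/-!
# The fork at [IUTchIII] Corollary 3.12 at a GENUINE input: the synthetic depth family CROSSES the band — the shallow
# regime is INHABITED (Cor312Of TRUE at small depth, kernel), the deep one too (FALSE at large depth, abc-iut-w5-d157)
# (skeleton XXVIIc, non-vacuity half)

Record-only file (D-0012) of the abc-iut cell (deliverable (a), skeleton seat abc-iut-skel, gen 7); TAKES NO SIDE.
Sequel to `ForkGenuineRegimes.lean` (p425602: `cor312Of_of_shallow` — `κ_l·deĝ̲(𝔮) ≤ ((l+5)/4)·log π ⟹ Cor312Of I`,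
`κ_l = (l+1)/24 − 1/(2l)`) read at abc-iut-w5-d157's SYNTHETIC Θ-volume inputs
`ThetaVolumeInput.deepAt p l N σ` (`LDHPerPrimeReadingWitness.lean` / `LDHPerPrimeReadingSlotConstant.lean`: over ANY number
fields `F₀ ⊆ K` and any section `σ` of places, pilot data `j_E := p^{−2lN}`, `S := V(F₀)_p`, ideles `t_{Θ,j,v} := p^{j²N}`,
`t_{q,v} := p^N` in the GENUINE completions `K_{v̲}` — inhabitants of abc-iut-S2/S7's input type chosen for their valuations;
`deepAt_negAbsLogQ'`: `−|log(q)| = −N·log p`). w5-d157 proved the DEEP side of the fork for this family: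
`exists_deepAt_not_cor312Of'` — for every `F₀, K, σ, p, l` SOME depth `N` makes `Cor312Of (deepAt p l N σ)` FALSE (the family is
slot-constant, so c312-d1's Step (v) discrepancy is `N`-free while `−|log(q)|` grows linearly). HERE the SHALLOW side:

* `ndeg_qDivisor_deepAt` — `deĝ̲(𝔮) = 2lN·log p` for the synthetic input (any base);
* **`cor312Of_deepAt_of_le`** — `((l+1)·l/12 − 1)·N·log p ≤ ((l+5)/4)·log π ⟹ Cor312Of (deepAt p l N σ)` — for EVERY `F₀, K, σ`:
  the typed inequality of [IUTchIII] Cor. 3.12 is TRUE at the synthetic input of small depth, by the free inequality and the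
  archimedean term alone (`cor312Of_of_shallow`);
* closed-form instances (`Real.log_two_lt_d9`; `1 < log π` from `exp 1 < 3 < π`, cf. the tree's `one_lt_log_pi`): **`cor312Of_deepAt_five_two_one`** / `…_five_two_two` /
  `…_five_three_one` / `…_seven_two_one` — `(l, p, N) = (5,2,1), (5,2,2), (5,3,1), (7,2,1)`, every `F₀, K, σ`;
* **`deepAt_family_crosses`** — for `(l, p) = (5, 2)` and every `F₀, K, σ`:
  `(∃ N, Cor312Of (deepAt 2 5 N σ)) ∧ (∃ N, ¬ Cor312Of (deepAt 2 5 N σ))` — along ONE integer parameter the synthetic family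
  realises BOTH truth values of the Corollary's typed inequality: the numerical fork of `HOME/skel/FORK-REAL-MODEL.md` §4/§9
  is INHABITED on both sides in the input type (general form `deepAt_family_crosses_of_le`).

HONEST SCOPE (as in w5-d157's files): these are inhabitants of the INPUT TYPE with genuine completions but SYNTHETIC ideles,
NOT the Θ-volume inputs of collections of initial Θ-data of [IUTchI] Def. 3.1 (there `K = F(E_F[l])`, the ideles are `2l`-th
roots of Tate parameters, and `deĝ̲(𝔮)` is what the curve dictates); sharp (Ind3), full (Ind1)/(Ind2). The theorems say that
the cell's typed `Cor312Of` is neither vacuously false nor vacuously true on the input type, and WHERE (in `deĝ̲(𝔮)`) each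
happens; they take no side on [IUTchIII] Cor. 3.12, whose content is the claim for ALL initial Θ-data; typed ≠ proved.
PROOF-ONLY file: no definitions, no `Prop` facts. [cite: DupuyHilado2025, §1 (1.1), §3.3, §3.9, Thm. 3.10.1]
[cite: Mochizuki2012, IUTchIII Cor. 3.12 p. 173–174] [cite: Mochizuki2012, IUTchIV Thm. 1.10 Step (vii) p. 30]
[claim: Mochizuki2012, status: disputed]
-/

noncomputable section

open Literature.IUT.LogVolume NumberField IsDedekindDomain

namespace Summit.ABC.IUTFork.GenuineContent

section DepthFamily

variable {F₀ : Type} [Field F₀] [NumberField F₀] {K : Type} [Field K] [NumberField K] [Algebra F₀ K]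
variable (p : ℕ) [hp : Fact p.Prime] (l : ℕ) (hl : l.Prime) (h5 : 5 ≤ l) (N : ℕ) (hN : 0 < N)
  (σ : PlaceSection F₀ K)

/-- **`deĝ̲(𝔮) = 2lN·log p` for the synthetic input** (from w5-d157's `deepAt_negAbsLogQ'`: `−|log(q)| = −N·log p`, and
`−|log(q)| = −(1/2l)·deĝ̲(𝔮)`). [cite: DupuyHilado2025, §3.3, Thm. 3.10.1] -/
theorem ndeg_qDivisor_deepAt :
    FinDivisor.ndeg F₀ (ThetaVolumeInput.deepAt p l hl h5 N hN σ).X.qDivisor = 2 * (l : ℝ) * N * Real.log p := by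
  have h1 := ThetaVolumeInput.deepAt_negAbsLogQ' p l hl h5 N hN σ
  have h2 : (ThetaVolumeInput.deepAt p l hl h5 N hN σ).negAbsLogQ =
      -(1 / (2 * (l : ℝ))) * FinDivisor.ndeg F₀ (ThetaVolumeInput.deepAt p l hl h5 N hN σ).X.qDivisor :=
    (ThetaVolumeInput.deepAt p l hl h5 N hN σ).negAbsLogQ_eq
  have hl0 : (l : ℝ) ≠ 0 := by exact_mod_cast hl.ne_zero
  have key : 1 / (2 * (l : ℝ)) * FinDivisor.ndeg F₀ (ThetaVolumeInput.deepAt p l hl h5 N hN σ).X.qDivisor =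
      (N : ℝ) * Real.log p := by linarith
  calc FinDivisor.ndeg F₀ (ThetaVolumeInput.deepAt p l hl h5 N hN σ).X.qDivisor
      = 2 * (l : ℝ) * (1 / (2 * (l : ℝ)) *
          FinDivisor.ndeg F₀ (ThetaVolumeInput.deepAt p l hl h5 N hN σ).X.qDivisor) := by
        field_simp
    _ = 2 * (l : ℝ) * N * Real.log p := by rw [key]; ring

/-- **THE SHALLOW SIDE OF THE SYNTHETIC FAMILY**: for every `F₀, K, σ`, if `((l+1)·l/12 − 1)·N·log p ≤ ((l+5)/4)·log π`
then `Cor312Of (deepAt p l N σ)` — [IUTchIII] Cor. 3.12's typed inequality HOLDS at the synthetic input of small depth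
(`κ_l·deĝ̲(𝔮) = κ_l·2lN·log p = ((l+1)l/12 − 1)·N·log p`, then `cor312Of_of_shallow`). [cite: Mochizuki2012, IUTchIV Thm. 1.10 Step (vii) p. 30]
[claim: Mochizuki2012, status: disputed] -/
theorem cor312Of_deepAt_of_le
    (h : (((l : ℝ) + 1) * l / 12 - 1) * ((N : ℝ) * Real.log p) ≤ ((l : ℝ) + 5) / 4 * Real.log Real.pi) :
    (ThetaVolumeInput.deepAt p l hl h5 N hN σ).Cor312Of := by
  refine cor312Of_of_shallow (ThetaVolumeInput.deepAt p l hl h5 N hN σ) ?_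
  show (((l : ℝ) + 1) / 24 - 1 / (2 * (l : ℝ))) *
      FinDivisor.ndeg F₀ (ThetaVolumeInput.deepAt p l hl h5 N hN σ).X.qDivisor ≤ ((l : ℝ) + 5) / 4 * Real.log Real.pi
  rw [ndeg_qDivisor_deepAt]
  have hl0 : (l : ℝ) ≠ 0 := by exact_mod_cast hl.ne_zero
  have hre : (((l : ℝ) + 1) / 24 - 1 / (2 * (l : ℝ))) * (2 * (l : ℝ) * N * Real.log p) =
      (((l : ℝ) + 1) * l / 12 - 1) * ((N : ℝ) * Real.log p) := by
    field_simp
    ring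
  rw [hre]
  exact h

/-- **Instance `(l, p, N) = (5, 2, 1)`**: `Cor312Of (deepAt 2 5 1 σ)` for every `F₀, K, σ` (`(3/2)·log 2 ≤ (5/2)·log π`).
[cite: Mochizuki2012, IUTchIII Cor. 3.12 p. 173–174] [claim: Mochizuki2012, status: disputed] -/
theorem cor312Of_deepAt_five_two_one :
    (ThetaVolumeInput.deepAt 2 5 Nat.prime_five le_rfl 1 Nat.one_pos σ).Cor312Of := by
  refine cor312Of_deepAt_of_le 2 5 Nat.prime_five le_rfl 1 Nat.one_pos σ ?_
  have h1 := Real.log_two_lt_d9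
  have h2 : 1 < Real.log Real.pi := by
    rw [Real.lt_log_iff_exp_lt Real.pi_pos]
    linarith [Real.exp_one_lt_d9, Real.pi_gt_three]
  push_cast
  nlinarith

/-- **Instance `(l, p, N) = (5, 2, 2)`**: `Cor312Of (deepAt 2 5 2 σ)` for every `F₀, K, σ` (`3·log 2 < 2.08 < (5/2)·log π`).
[cite: Mochizuki2012, IUTchIII Cor. 3.12 p. 173–174] [claim: Mochizuki2012, status: disputed] -/
theorem cor312Of_deepAt_five_two_two :
    (ThetaVolumeInput.deepAt 2 5 Nat.prime_five le_rfl 2 two_pos σ).Cor312Of := by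
  refine cor312Of_deepAt_of_le 2 5 Nat.prime_five le_rfl 2 two_pos σ ?_
  have h1 := Real.log_two_lt_d9
  have h2 : 1 < Real.log Real.pi := by
    rw [Real.lt_log_iff_exp_lt Real.pi_pos]
    linarith [Real.exp_one_lt_d9, Real.pi_gt_three]
  push_cast
  nlinarith

/-- **Instance `(l, p, N) = (5, 3, 1)`**: `Cor312Of (deepAt 3 5 1 σ)` for every `F₀, K, σ` (`(3/2)·log 3 < (5/2)·log π` as `3 < π`).
[cite: Mochizuki2012, IUTchIII Cor. 3.12 p. 173–174] [claim: Mochizuki2012, status: disputed] -/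
theorem cor312Of_deepAt_five_three_one :
    (ThetaVolumeInput.deepAt 3 5 Nat.prime_five le_rfl 1 Nat.one_pos σ).Cor312Of := by
  refine cor312Of_deepAt_of_le 3 5 Nat.prime_five le_rfl 1 Nat.one_pos σ ?_
  have h1 : Real.log 3 < Real.log Real.pi := Real.log_lt_log (by norm_num) Real.pi_gt_three
  have h2 : 1 < Real.log Real.pi := by
    rw [Real.lt_log_iff_exp_lt Real.pi_pos]
    linarith [Real.exp_one_lt_d9, Real.pi_gt_three]
  push_cast
  nlinarith

/-- **Instance `(l, p, N) = (7, 2, 1)`**: `Cor312Of (deepAt 2 7 1 σ)` for every `F₀, K, σ` (`(11/3)·log 2 < 2.55 < 3·log π`).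
[cite: Mochizuki2012, IUTchIII Cor. 3.12 p. 173–174] [claim: Mochizuki2012, status: disputed] -/
theorem cor312Of_deepAt_seven_two_one :
    (ThetaVolumeInput.deepAt 2 7 Nat.prime_seven (by norm_num) 1 Nat.one_pos σ).Cor312Of := by
  refine cor312Of_deepAt_of_le 2 7 Nat.prime_seven (by norm_num) 1 Nat.one_pos σ ?_
  have h1 := Real.log_two_lt_d9
  have h2 : 1 < Real.log Real.pi := by
    rw [Real.lt_log_iff_exp_lt Real.pi_pos]
    linarith [Real.exp_one_lt_d9, Real.pi_gt_three]
  push_cast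
  nlinarith

/-- **THE SYNTHETIC FAMILY CROSSES THE BAND** (general form): for every `F₀, K, σ, p, l` with
`((l+1)·l/12 − 1)·log p ≤ ((l+5)/4)·log π` (depth `1` is shallow), the one-parameter family `N ↦ deepAt p l N σ` realises BOTH
truth values of the typed inequality of [IUTchIII] Cor. 3.12: TRUE at `N = 1` (`cor312Of_deepAt_of_le`) and FALSE at some
`N` (w5-d157's `exists_deepAt_not_cor312Of'`). [cite: DupuyHilado2025, §1 (1.1), Thm. 3.10.1]
[claim: Mochizuki2012, status: disputed] -/
theorem deepAt_family_crosses_of_le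
    (h : (((l : ℝ) + 1) * l / 12 - 1) * Real.log p ≤ ((l : ℝ) + 5) / 4 * Real.log Real.pi) :
    (∃ (N : ℕ) (hN : 0 < N), (ThetaVolumeInput.deepAt p l hl h5 N hN σ).Cor312Of) ∧
      (∃ (N : ℕ) (hN : 0 < N), ¬ (ThetaVolumeInput.deepAt p l hl h5 N hN σ).Cor312Of) :=
  ⟨⟨1, Nat.one_pos, cor312Of_deepAt_of_le p l hl h5 1 Nat.one_pos σ (by push_cast; linarith)⟩,
    ThetaVolumeInput.exists_deepAt_not_cor312Of' p l hl h5 σ⟩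

/-- **THE SYNTHETIC FAMILY CROSSES THE BAND at `(l, p) = (5, 2)`, unconditionally, for every `F₀, K, σ`**:
`(∃ N, Cor312Of (deepAt 2 5 N σ)) ∧ (∃ N, ¬ Cor312Of (deepAt 2 5 N σ))` — the cell's typed `Cor312Of` is neither vacuously
true nor vacuously false on the input type, and one integer (the depth `N`, i.e. `deĝ̲(𝔮) = 10N·log 2`) moves it across the
band of `ForkGenuineRegimes` / `ForkGenuineWindow`. Synthetic ideles, not initial Θ-data; no side taken.
[cite: DupuyHilado2025, §1 (1.1), Thm. 3.10.1] [claim: Mochizuki2012, status: disputed] -/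
theorem deepAt_family_crosses :
    (∃ (N : ℕ) (hN : 0 < N), (ThetaVolumeInput.deepAt 2 5 Nat.prime_five le_rfl N hN σ).Cor312Of) ∧
      (∃ (N : ℕ) (hN : 0 < N), ¬ (ThetaVolumeInput.deepAt 2 5 Nat.prime_five le_rfl N hN σ).Cor312Of) :=
  ⟨⟨1, Nat.one_pos, cor312Of_deepAt_five_two_one σ⟩,
    ThetaVolumeInput.exists_deepAt_not_cor312Of' 2 5 Nat.prime_five le_rfl σ⟩

end DepthFamily

end Summit.ABC.IUTFork.GenuineContent

end
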